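import Summits.NavierStokesRegularity.NavierStokesRegularity.Theorems.TerminalTraceTypeITraceScarL3CentreEnstrophyUnit
import Literature.Analysis.FluidPDE.LocalTypeIScaling
import Literature.Analysis.FluidPDE.CKNScalingExtras
import Literature.Analysis.FluidPDE.AncientLimitVanishingScaled
import Literature.Analysis.FluidPDE.DirectionDissipation
import HarnessLib

/-!
# STUB `stub_centreEnstrophyAtDepth` (Q1) of line `annulus-dichotomy` (skeleton v4, sha16 3f7a14107033987a)
# for item `TerminalTrace.TypeITraceScarL3` (stmt-NavierStokesRegularity-18385) — PROVED

Seat nsreg-C26-p1 (prover), `--supports stmt-NavierStokesRegularity-18385`; planner of record nsreg-p2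
g28 (ROUND-26 §1c (Q1) «centre concentration at depth»; R26-Q1-targets K0/K1/K2).

The registered signature, VERBATIM: for every class `(M, D₀, C)` there are `κ₀ > 0` and
`c₂ ∈ ]0, ½[` such that every extinct Type-I apex of the class (suitable in every `Q(a)`, weak gradient,
`𝐈 ≤ M`, plain `D ≤ D₀` at apices `≤ 0`, rate `C/√(−s)`, weakly null at the top) which IS
backward-singular at the origin has, at EVERY scale `T₁ > 0`, a time `t₁ ∈ [−T₁, −T₁/2]` such that
EVERY continuous `C¹`-sliced representative `V` of `U` on `]−2T₁, −T₁/4[ × ℝ³` carries centre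
enstrophy `∫_{B(0,√T₁)} |curl V(t)|² ≥ κ₀ T₁^{-1/2}` for all `t ∈ [t₁ − c₂T₁, t₁]`.

Proof: the unit-scale theorem `centreEnstrophyAtDepth_unit` applied to the parabolic zoom
`U' = μU(μ²·, μ·)`, `μ = √T₁` (the class and the singular origin are invariant:
`IsSuitableWeakSolutionInBall.zoomOut`, `HasWeakSpatialGradientOn.stRescale`, `typeIBound_nsZoom`,
`cknD_nsZoom`, `Measure.quasiMeasurePreserving_smul`, `eLpNorm_top_nsZoom`), the representative being
zoomed along (`quasiMeasurePreserving_parabolicDilation`), and the enstrophy rescaled by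
`curl_smul_stPull` and `Measure.setIntegral_comp_smul_of_pos`:
`∫_{B(0,1)} |curl V'(s)|² = √T₁ ∫_{B(0,√T₁)} |curl V(T₁ s)|²`.  The weak-extinction clause `htop` and the
`C¹` clause on `V` are not used.

WHAT THIS IS NOT: not Stub QA / LOUD, not item 18385, no statement about Navier–Stokes regularity.
[folklore; AlbrittonBarker2019 §3; Tao2021 §5 (5.3)–(5.6); EscauriazaSereginSverak2003 §3]
-/

noncomputable section

set_option linter.dupNamespace false

namespace Summit.NavierStokesRegularity.NavierStokesRegularity.Theorems.TypeITraceScarL3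

open MeasureTheory Set Function Filter Topology TopologicalSpace Metric InnerProductSpace
open Literature.Analysis Literature.Analysis.FluidPDE
open scoped NNReal ENNReal RealInnerProductSpace

/-- **STUB `stub_centreEnstrophyAtDepth` (Q1 of ROUND-26, skeleton v4 of line `annulus-dichotomy`),
registered signature verbatim** — the class-uniform centre enstrophy floor on a time interval at every
depth for backward-singular extinct Type-I apices; parabolic rescaling of `centreEnstrophyAtDepth_unit`.
[folklore; AlbrittonBarker2019 §3; Tao2021 §5 (5.3)–(5.6); EscauriazaSereginSverak2003 §3] -/
theorem stub_centreEnstrophyAtDepth :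
    ∀ (M D₀ : ℝ≥0) (C : ℝ), ∃ κ₀ : ℝ, 0 < κ₀ ∧ ∃ c₂ : ℝ, 0 < c₂ ∧ c₂ < 1 / 2 ∧
    ∀ (U : ℝ → EuclideanSpace ℝ (Fin 3) → EuclideanSpace ℝ (Fin 3))
      (P : ℝ → EuclideanSpace ℝ (Fin 3) → ℝ)
      (G : ℝ → EuclideanSpace ℝ (Fin 3) →
        EuclideanSpace ℝ (Fin 3) →L[ℝ] EuclideanSpace ℝ (Fin 3)),
      (∀ a : ℝ, 0 < a →
        IsSuitableWeakSolutionInBall a (0 : ℝ × EuclideanSpace ℝ (Fin 3)) U P) →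
      (∀ a : ℝ, 0 < a →
        HasWeakSpatialGradientOn
          (parabolicCylinderOpens a (0 : ℝ × EuclideanSpace ℝ (Fin 3))) U G) →
      (∀ a : ℝ, 0 < a →
        typeIBound (parabolicCylinder a (0 : ℝ × EuclideanSpace ℝ (Fin 3))) U P G ≤ M) →
      (∀ z₀ : ℝ × EuclideanSpace ℝ (Fin 3), z₀.1 ≤ 0 →
        ∀ r : ℝ, 0 < r → cknD r z₀ P ≤ D₀) →
      (∀ s : ℝ, s < 0 →
        ∀ᵐ y : EuclideanSpace ℝ (Fin 3), ‖U s y‖ ≤ C / Real.sqrt (-s)) →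
      (∀ φ : EuclideanSpace ℝ (Fin 3) → EuclideanSpace ℝ (Fin 3),
        ContDiff ℝ (⊤ : ℕ∞) φ →
        HasCompactSupport φ → ∀ ε : ℝ, 0 < ε →
        ∃ s₀ : ℝ, s₀ < 0 ∧ ∀ᵐ s ∂(volume.restrict (Ioo s₀ 0)), |∫ y, ⟪U s y, φ y⟫| ≤ ε) →
      IsBackwardSingularPoint U (0 : ℝ × EuclideanSpace ℝ (Fin 3)) →
      (∀ T₁ : ℝ, 0 < T₁ → ∃ t₁ ∈ Icc (-T₁) (-T₁ / 2),
        ∀ V : ℝ → EuclideanSpace ℝ (Fin 3) → EuclideanSpace ℝ (Fin 3),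
          Function.uncurry V =ᵐ[volume.restrict
              (Ioo (-2 * T₁) (-T₁ / 4) ×ˢ (univ : Set (EuclideanSpace ℝ (Fin 3))))]
            Function.uncurry U →
          ContinuousOn (Function.uncurry V)
            (Ioo (-2 * T₁) (-T₁ / 4) ×ˢ (univ : Set (EuclideanSpace ℝ (Fin 3)))) →
          (∀ t ∈ Ioo (-2 * T₁) (-T₁ / 4), ContDiff ℝ 1 (V t)) →
          ∀ t ∈ Icc (t₁ - c₂ * T₁) t₁,
            κ₀ * T₁ ^ (-(1 / 2 : ℝ)) ≤
              ∫ x in ball (0 : EuclideanSpace ℝ (Fin 3)) (Real.sqrt T₁), ‖curl (V t) x‖ ^ 2) := by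
  intro M D₀ C
  obtain ⟨κ, hκ, c₂, hc₂0, hc₂, hunit⟩ := centreEnstrophyAtDepth_unit M D₀ C
  refine ⟨κ, hκ, c₂, hc₂0, hc₂, ?_⟩
  intro U P G hsw hG hI hD hrate _htop hsing T₁ hT₁
  -- ### the scale `μ = √T₁`
  set μ : ℝ := Real.sqrt T₁ with hμdef
  have hμpos : 0 < μ := Real.sqrt_pos.2 hT₁
  have hμ0 : μ ≠ 0 := hμpos.ne'
  have hμ2 : 0 < μ ^ 2 := pow_pos hμpos 2
  have hμsq : μ ^ 2 = T₁ := Real.sq_sqrt hT₁.le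
  -- ### the rescaled triple
  set U' : ℝ → EuclideanSpace ℝ (Fin 3) → EuclideanSpace ℝ (Fin 3) :=
    μ • stPull (μ ^ 2) μ (0 : ℝ) (0 : EuclideanSpace ℝ (Fin 3)) U with hU'def
  set P' : ℝ → EuclideanSpace ℝ (Fin 3) → ℝ :=
    μ ^ 2 • stPull (μ ^ 2) μ (0 : ℝ) (0 : EuclideanSpace ℝ (Fin 3)) P with hP'def
  set G' : ℝ → EuclideanSpace ℝ (Fin 3) → EuclideanSpace ℝ (Fin 3) →L[ℝ] EuclideanSpace ℝ (Fin 3) :=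
    μ ^ 2 • stPull (μ ^ 2) μ (0 : ℝ) (0 : EuclideanSpace ℝ (Fin 3)) G with hG'def
  have hU'apply : ∀ s y, U' s y = μ • U (μ ^ 2 * s) (μ • y) := fun s y => by
    rw [hU'def]; simp only [Pi.smul_apply, stPull_apply, zero_add]
  have hst0 : ∀ z : ℝ × EuclideanSpace ℝ (Fin 3),
      stAffine (μ ^ 2) μ (0 : ℝ) (0 : EuclideanSpace ℝ (Fin 3)) z = (μ ^ 2 * z.1, μ • z.2) := by
    intro z
    rw [show z = (z.1, z.2) from rfl, stAffine_apply, zero_add, zero_add]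
  -- (i) suitable in every `Q(a)`
  have hsw' : ∀ a : ℝ, 0 < a →
      IsSuitableWeakSolutionInBall a (0 : ℝ × EuclideanSpace ℝ (Fin 3)) U' P' := by
    intro a ha
    have h := (hsw (a * μ) (mul_pos ha hμpos)).zoomOut hμpos
    rwa [mul_div_cancel_right₀ a hμ0] at h
  -- (ii) the weak gradient
  have hG' : ∀ a : ℝ, 0 < a →
      HasWeakSpatialGradientOn (parabolicCylinderOpens a (0 : ℝ × EuclideanSpace ℝ (Fin 3))) U' G' := by
    intro a ha
    have h := (hG (a * μ) (mul_pos ha hμpos)).stRescale μ hμ2 hμpos (0 : ℝ)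
      (0 : EuclideanSpace ℝ (Fin 3))
    have hpre : stPreimage (μ ^ 2) μ (0 : ℝ) (0 : EuclideanSpace ℝ (Fin 3))
        (parabolicCylinderOpens (a * μ) (0 : ℝ × EuclideanSpace ℝ (Fin 3))) =
        parabolicCylinderOpens a (0 : ℝ × EuclideanSpace ℝ (Fin 3)) := by
      apply TopologicalSpace.Opens.ext
      rw [coe_stPreimage, coe_parabolicCylinderOpens, coe_parabolicCylinderOpens,
        stAffine_preimage_parabolicCylinder_zero hμpos, mul_div_cancel_right₀ a hμ0]
    rw [hpre, show μ * μ = μ ^ 2 by ring] at h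
    exact h
  -- (iii) `𝐈 ≤ M`
  have hI' : ∀ a : ℝ, 0 < a →
      typeIBound (parabolicCylinder a (0 : ℝ × EuclideanSpace ℝ (Fin 3))) U' P' G' ≤ M := by
    intro a ha
    rw [← mul_div_cancel_right₀ a hμ0, ← stAffine_preimage_parabolicCylinder_zero hμpos (a * μ),
      hU'def, hP'def, hG'def, typeIBound_nsZoom hμpos]
    exact hI (a * μ) (mul_pos ha hμpos)
  -- (iv) the plain pressure bound
  have hD' : ∀ z₀ : ℝ × EuclideanSpace ℝ (Fin 3), z₀.1 ≤ 0 → ∀ r : ℝ, 0 < r → cknD r z₀ P' ≤ D₀ := by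
    intro z₀ hz₀ r hr
    rw [hP'def, cknD_nsZoom hμpos hr 0 0 z₀ P]
    refine hD _ ?_ (μ * r) (mul_pos hμpos hr)
    rw [hst0]
    exact mul_nonpos_of_nonneg_of_nonpos hμ2.le hz₀
  -- (v) the rate
  have hrate' : ∀ s : ℝ, s < 0 → ∀ᵐ y : EuclideanSpace ℝ (Fin 3), ‖U' s y‖ ≤ C / Real.sqrt (-s) := by
    -- adapted from `stub_no_confinedExtinctApex` (step (v))
    intro s hs
    have hs2 : μ ^ 2 * s < 0 := mul_neg_of_pos_of_neg hμ2 hs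
    have h := (Measure.quasiMeasurePreserving_smul volume hμ0).ae (hrate (μ ^ 2 * s) hs2)
    filter_upwards [h] with y hy
    have hsq : Real.sqrt (-(μ ^ 2 * s)) = μ * Real.sqrt (-s) := by
      rw [show -(μ ^ 2 * s) = μ ^ 2 * (-s) by ring, Real.sqrt_mul hμ2.le, Real.sqrt_sq hμpos.le]
    rw [hU'apply, norm_smul, Real.norm_eq_abs, abs_of_pos hμpos]
    have hy' : ‖U (μ ^ 2 * s) (μ • y)‖ ≤ C / (μ * Real.sqrt (-s)) := by rw [← hsq]; exact hy
    calc μ * ‖U (μ ^ 2 * s) (μ • y)‖ ≤ μ * (C / (μ * Real.sqrt (-s))) :=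
          mul_le_mul_of_nonneg_left hy' hμpos.le
      _ = C / Real.sqrt (-s) := by field_simp
  -- (vi) the origin stays backward-singular
  have hsing' : IsBackwardSingularPoint U' (0 : ℝ × EuclideanSpace ℝ (Fin 3)) := by
    intro r hr
    rw [hU'def, eLpNorm_top_nsZoom hμpos, hst0]
    simp only [Prod.fst_zero, Prod.snd_zero, mul_zero, smul_zero]
    rw [show ((0 : ℝ), (0 : EuclideanSpace ℝ (Fin 3))) = (0 : ℝ × EuclideanSpace ℝ (Fin 3)) from rfl,
      hsing (μ * r) (mul_pos hμpos hr)]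
    exact ENNReal.mul_top (by simpa using hμpos)
  -- ### the unit-scale statement for the rescaled triple
  obtain ⟨s₁, hs₁, hfloor⟩ := hunit U' P' G' hsw' hG' hI' hD' hrate' hsing'
  refine ⟨T₁ * s₁, ⟨by nlinarith [hs₁.1], by nlinarith [hs₁.2]⟩, ?_⟩
  intro V hVU hVc _ t ht
  -- ### the zoomed representative
  set V' : ℝ → EuclideanSpace ℝ (Fin 3) → EuclideanSpace ℝ (Fin 3) :=
    μ • stPull (μ ^ 2) μ (0 : ℝ) (0 : EuclideanSpace ℝ (Fin 3)) V with hV'def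
  have hV'apply : ∀ s y, V' s y = μ • V (μ ^ 2 * s) (μ • y) := fun s y => by
    rw [hV'def]; simp only [Pi.smul_apply, stPull_apply, zero_add]
  set ST : Set (ℝ × EuclideanSpace ℝ (Fin 3)) :=
    Ioo (-2 * T₁) (-T₁ / 4) ×ˢ (univ : Set (EuclideanSpace ℝ (Fin 3))) with hSTdef
  set S1 : Set (ℝ × EuclideanSpace ℝ (Fin 3)) :=
    Ioo (-2 : ℝ) (-1 / 4) ×ˢ (univ : Set (EuclideanSpace ℝ (Fin 3))) with hS1def
  have hmaps : ∀ z : ℝ × EuclideanSpace ℝ (Fin 3), z ∈ S1 →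
      ((μ ^ 2 * z.1, μ • z.2) : ℝ × EuclideanSpace ℝ (Fin 3)) ∈ ST := by
    rintro ⟨s, y⟩ ⟨hs, -⟩
    refine ⟨⟨?_, ?_⟩, mem_univ _⟩
    · show -2 * T₁ < μ ^ 2 * s
      rw [hμsq]; nlinarith [hs.1]
    · show μ ^ 2 * s < -T₁ / 4
      rw [hμsq]; nlinarith [hs.2]
  have hV'U' : uncurry V' =ᵐ[volume.restrict S1] uncurry U' := by
    have hSTm : MeasurableSet ST := measurableSet_Ioo.prod MeasurableSet.univ
    have hS1m : MeasurableSet S1 := measurableSet_Ioo.prod MeasurableSet.univ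
    have h1 := (ae_restrict_iff' hSTm).1 hVU
    show ∀ᵐ z ∂(volume.restrict S1), uncurry V' z = uncurry U' z
    rw [ae_restrict_iff' hS1m]
    filter_upwards [(quasiMeasurePreserving_parabolicDilation hμ0).ae h1] with z hz hzS
    have h := hz (hmaps z hzS)
    show V' z.1 z.2 = U' z.1 z.2
    rw [hV'apply, hU'apply]
    exact congrArg (fun w => μ • w) h
  have hV'c : ContinuousOn (uncurry V') S1 := by
    have hφ : Continuous fun z : ℝ × EuclideanSpace ℝ (Fin 3) =>
        ((μ ^ 2 * z.1, μ • z.2) : ℝ × EuclideanSpace ℝ (Fin 3)) := by fun_prop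
    have h1 : ContinuousOn (fun z : ℝ × EuclideanSpace ℝ (Fin 3) => uncurry V (μ ^ 2 * z.1, μ • z.2)) S1 :=
      hVc.comp hφ.continuousOn fun z hz => hmaps z hz
    exact (h1.const_smul μ).congr fun z _ => by
      show V' z.1 z.2 = μ • uncurry V (μ ^ 2 * z.1, μ • z.2)
      rw [hV'apply]; rfl
  -- ### the floor at the rescaled time `s = t / T₁`
  set s : ℝ := t / T₁ with hsdef
  have hts : μ ^ 2 * s = t := by rw [hμsq, hsdef]; field_simp
  have hsI : s ∈ Icc (s₁ - c₂) s₁ := by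
    rw [hsdef]
    constructor
    · rw [le_div_iff₀ hT₁]; nlinarith [ht.1]
    · rw [div_le_iff₀ hT₁]; nlinarith [ht.2]
  have hfl := hfloor V' hV'U' hV'c s hsI
  -- ### rescale the enstrophy integral
  have hcurl : ∀ y, curl (V' s) y = μ ^ 2 • curl (V t) (μ • y) := fun y => by
    rw [hV'def, curl_smul_stPull, zero_add, zero_add, hts, show μ * μ = μ ^ 2 by ring]
  have hint : ∫ y in ball (0 : EuclideanSpace ℝ (Fin 3)) 1, ‖curl (V' s) y‖ ^ 2 =
      μ * ∫ x in ball (0 : EuclideanSpace ℝ (Fin 3)) (Real.sqrt T₁), ‖curl (V t) x‖ ^ 2 := by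
    have e1 : ∀ y, ‖curl (V' s) y‖ ^ 2 =
        μ ^ 4 * (fun x => ‖curl (V t) x‖ ^ 2) (μ • y) := fun y => by
      rw [hcurl y, norm_smul, Real.norm_eq_abs, abs_of_pos hμ2]
      ring
    have e2 : ∫ y in ball (0 : EuclideanSpace ℝ (Fin 3)) 1, (fun x => ‖curl (V t) x‖ ^ 2) (μ • y) =
        (μ ^ 3)⁻¹ * ∫ x in ball (0 : EuclideanSpace ℝ (Fin 3)) μ, ‖curl (V t) x‖ ^ 2 := by
      have h := Measure.setIntegral_comp_smul_of_pos (μ := volume)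
        (fun x : EuclideanSpace ℝ (Fin 3) => ‖curl (V t) x‖ ^ 2) (ball (0 : EuclideanSpace ℝ (Fin 3)) 1)
        hμpos
      rw [finrank_euclideanSpace_fin, smul_unitBall_of_pos hμpos, smul_eq_mul] at h
      exact h
    simp_rw [e1]
    rw [integral_const_mul, e2, ← hμdef]
    field_simp
  rw [hint] at hfl
  -- `κ T₁^{-1/2} = κ / μ`
  have hpow : T₁ ^ (-(1 / 2 : ℝ)) = μ⁻¹ := by
    rw [Real.rpow_neg hT₁.le, hμdef, Real.sqrt_eq_rpow]
  rw [hpow, ← div_eq_mul_inv, div_le_iff₀ hμpos, mul_comm]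
  exact hfl

end Summit.NavierStokesRegularity.NavierStokesRegularity.Theorems.TypeITraceScarL3

end
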